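import Summits.BirchSwinnertonDyer.BirchSwinnertonDyer.Theorems.AdditiveBranchIMCGordTwoRankOneHeegnerKolyvaginSmallImageClassNumber
import Summits.BirchSwinnertonDyer.BirchSwinnertonDyer.Theorems.AdditiveBranchIMCGordTwoRankOneSmallImageDicksonTwist
import HarnessLib

/-!
# Route `AdditiveBranchIMC` (rung K1), crux `GordTwoRankOne` (item 19358): Part 16's class-number road with
# certificate clause (i) `p ∤ #Gal(ℚ(Wd[p])/ℚ)` DISCHARGED by Serre 1972 Prop. 15 (Dickson) — the per-pair
# certificate shrinks to (ii) `p ∤ h(ℚ(Wd[p]))` + (iii) local `p`-torsion; the only residual image input is the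
# level-one non-surjectivity at `p = 3` (cell `bsd-addord`, seat w2-acc5 gen 8; `--supports 19358`, helper)

HONEST FRAMING.  THEOREMS ONLY (no definition, no named fact, no instance, no `sorry`); nothing is booked; the
crux stays OPEN; «BSD is not proved by any of this».  This file COMPOSES k1-c3x gen 2's p547579
`cellGordTwo_missingLowerBoundAt_rankOne_of_smallImage_of_adjustedIndexBound_of_classNumber` with this seat's
`not_dvd_card_aut_divisionField_of_smul_eq_quadraticTwist` (p552299 / the Twist sequel): clause (i) of `hClsm`
is a THEOREM on every row whose mod-`p` image is not onto AT LEVEL `p`; for `p ≥ 5` that is the row's own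
small-image hypothesis `¬ ∀ n, W.HasSurjectiveModNGaloisRep (p ^ n)` by Serre's lifting lemma (tree theorem
`serre_hasSurjectiveModNGaloisRep_pow_holds`), and at `p = 3` it is an explicit row condition (3Ns / 3Nn;
FALSE on the 9-defective rows that are onto mod `3`, where Deo–Ray–Sujatha's road does not apply: `3 ∣ 48`).

* ★ `cellGordTwo_missingLowerBoundAt_rankOne_of_smallImage_of_adjustedIndexBound_of_classNumber_levelOne` —
  PUB (`hGZ hKo hKatoI hDRS hGZK hmod hnf hmodP hFH`) + `hLsm` (STEP L′, OPEN) + `hns3` (level-one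
  non-surjectivity on the `p = 3` rows) + `hClsm'` = per twist ONLY (ii) `p ∤ h(ℚ(Wd[p]))` and (iii) no non-zero
  decomposition-fixed `p`-torsion at `p` and at the bad places ⟹ the crux's conclusion on the small-image rows.

References: Serre, Invent. Math. 15 (1972) §2.4 Prop. 15 [Serre1972]; Serre, *Abelian ℓ-adic representations*
(1968) IV §3.4 [SerreAbelianLadic1968]; Deo–Ray–Sujatha (2023) Thm. 3.9, Lemma 5.1 [DeoRaySujatha2023];
Jetchev–Skinner–Wan (2017) §7.4.1 [JetchevSkinnerWan2017].
-/

set_option autoImplicit false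
set_option linter.dupNamespace false
noncomputable section

open scoped Classical NumberField
open WeierstrassCurve NumberField IsDedekindDomain
  Literature.NumberTheory.EllipticCurves Literature.NumberTheory.EllipticCurves.ModularForms
  Literature.NumberTheory.EllipticCurves.Rank1Residual
  Literature.NumberTheory.EllipticCurves.Rank1Residual.Typed
  Literature.NumberTheory.IwasawaTheory
  Summit.BirchSwinnertonDyer.Rank1Residual
  Summit.BirchSwinnertonDyer.Rank1Residual.Additive
  Summit.BirchSwinnertonDyer.Rank1Residual.X11b
  Summit.BirchSwinnertonDyer.Rank1Residual.GaloisImage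
  Literature.NumberTheory.Automorphic
  Summit.BirchSwinnertonDyer.BirchSwinnertonDyer.Theses.AdditiveBranchIMC
  Summit.BirchSwinnertonDyer.BirchSwinnertonDyer.Theorems.AdditiveBranchIMCGordTwoRankOne

namespace Summit.BirchSwinnertonDyer.BirchSwinnertonDyer.Theorems.AdditiveBranchIMCGordTwoRankOne.SmallImageDickson

/-- Level-one non-surjectivity on a small-image row of the cell: automatic at `p ≥ 5` (Serre's lifting lemma,
`serre_hasSurjectiveModNGaloisRep_pow_holds`), a displayed row condition at `p = 3` (`p ≠ 2` on the cell).
[cite: SerreAbelianLadic1968, Ch. IV §3.4] -/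
theorem not_hasSurjectiveModNGaloisRep_of_row (W : WeierstrassCurve ℚ) [W.IsElliptic] (p : ℕ) [Fact p.Prime]
    (hp2 : p ≠ 2) (hns : ¬ ∀ n : ℕ, W.HasSurjectiveModNGaloisRep (p ^ n : ℕ))
    (hns3 : p = 3 → ¬ W.HasSurjectiveModNGaloisRep p) : ¬ W.HasSurjectiveModNGaloisRep p := by
  by_cases h3 : p = 3
  · exact hns3 h3
  · have hp5 : 5 ≤ p := by
      have hpr : p.Prime := Fact.out
      rcases hpr.eq_two_or_odd' with h2 | hodd
      · exact absurd h2 hp2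
      · have h4 : p ≠ 4 := fun h ↦ by
          rw [h] at hpr; exact absurd hpr (by decide)
        have h1 : 2 ≤ p := hpr.two_le
        omega
    exact fun h ↦ hns (serre_hasSurjectiveModNGaloisRep_pow_holds W p hp5 h)

/-- ★ **Part 16's class-number road with clause (i) discharged.**  k1-c3x's
`cellGordTwo_missingLowerBoundAt_rankOne_of_smallImage_of_adjustedIndexBound_of_classNumber` (p547579) with the
per-twist certificate REDUCED to (ii) `p ∤ h(ℚ(Wd[p]))` and (iii) the local `p`-torsion clause: conjunct (i)
`p ∤ #Gal(ℚ(Wd[p])/ℚ)` is `not_dvd_card_aut_divisionField_of_smul_eq_quadraticTwist` (Serre Prop. 15 for `W`,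
transported to the twist; `p ≠ 2` from `N10.CellGordTwo`, `disc K ≠ 0`), given level-one non-surjectivity —
the row's own hypothesis at `p ≥ 5`, the displayed `hns3` at `p = 3`.  PUBLISHED binders: `hGZ`, `hKo`, `hKatoI`,
`hDRS`, `hGZK`, `hmod`, `hnf`, `hmodP`, `hFH`; OPEN: `hLsm` (STEP L′); ROW DATA: `hns3`, `hClsm'`.  Nothing booked.
[cite: Serre1972, §2.4 Prop. 15] [cite: DeoRaySujatha2023, §3 Thm. 3.9 (b) and §5 Lemma 5.1]
[cite: JetchevSkinnerWan2017, §7.4.1 (pp. 29–31)] -/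
theorem cellGordTwo_missingLowerBoundAt_rankOne_of_smallImage_of_adjustedIndexBound_of_classNumber_levelOne
    (hGZ : ∀ (N : ℕ) [NeZero N] (W : WeierstrassCurve ℚ) (K : Type) [Field K] [NumberField K],
      gross_zagier N W K)
    (hKo : ∀ (N : ℕ) [NeZero N] (W : WeierstrassCurve ℚ) (K : Type) [Field K] [NumberField K],
      kolyvagin N W K)
    (hKatoI : Kato2004.rankZero_padicValNat_sha_add_padicValNat_tamagawa_le_of_additive_potGood_of_irreducible_of_fineSelmerDual_fg)
    (hDRS : DeoRaySujatha2023.thm39_fineSelmerDual_moduleFinite_of_classNumber_divisionField)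
    (hGZK : rank_eq_analyticRank_of_analyticRank_le_one) (hmod : hasEntireLFunction_rat)
    (hnf : exists_isNewformOf) (hmodP : nonempty_modularParametrizationData)
    (hFH : friedbergHoffstein_exists_heegnerField_split_twist_ne_zero)
    (hLsm : ∀ (W : WeierstrassCurve ℚ) [W.IsElliptic] [W.IsGloballyMinimal] (p : ℕ) [Fact p.Prime]
      (N : ℕ) [NeZero N] (K : Type) [Field K] [NumberField K]
      (Dt : ModularParametrizationData W N) (H : HeegnerDatum N (NumberField.discr K)) (ι : K →+* ℂ)
      (P : (W.baseChange K).toAffine.Point)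
      (Wd : WeierstrassCurve ℚ) [Wd.IsElliptic] [Wd.IsGloballyMinimal] (Cd : VariableChange ℚ),
      W.analyticRank = 1 → N10.CellGordTwo W p → W.HasIrreducibleModPGaloisRep p →
      ¬ (∀ n : ℕ, W.HasSurjectiveModNGaloisRep (p ^ n : ℕ)) →
      W.conductorNorm ℤ = N → IsImaginaryQuadratic K → SatisfiesHeegnerHypothesis N K →
      WeierstrassCurve.Affine.Point.map ι.toRatAlgHom P = heegnerPointComplex Dt H →
      Cd • W.quadraticTwist (NumberField.discr K : ℚ) = Wd →
      Finite (W.baseChange K).sha →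
      (2 * padicValNat p (AddSubgroup.zmultiples P).index : ℤ) ≤
        padicValNat p (W.baseChange K).shaOrder + padicValNat p W.tamagawaProduct +
          padicValNat p Wd.tamagawaProduct + 2 * padicValRat p (Dt.c : ℚ))
    (hns3 : ∀ (W : WeierstrassCurve ℚ) [W.IsElliptic] [W.IsGloballyMinimal],
      W.analyticRank = 1 → N10.CellGordTwo W 3 → W.HasIrreducibleModPGaloisRep 3 →
      ¬ (∀ n : ℕ, W.HasSurjectiveModNGaloisRep (3 ^ n : ℕ)) → ¬ W.HasSurjectiveModNGaloisRep (3 : ℕ))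
    (hClsm' : ∀ (W : WeierstrassCurve ℚ) [W.IsElliptic] [W.IsGloballyMinimal] (p : ℕ) [Fact p.Prime]
      (K : Type) [Field K] [NumberField K]
      (Wd : WeierstrassCurve ℚ) [Wd.IsElliptic] [Wd.IsGloballyMinimal] (Cd : VariableChange ℚ),
      W.analyticRank = 1 → N10.CellGordTwo W p → W.HasIrreducibleModPGaloisRep p →
      ¬ (∀ n : ℕ, W.HasSurjectiveModNGaloisRep (p ^ n : ℕ)) →
      IsImaginaryQuadratic K → SatisfiesHeegnerHypothesis (W.conductorNorm ℤ) K →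
      (W.quadraticTwist (NumberField.discr K : ℚ)).entireLFunction 1 ≠ 0 →
      Cd • W.quadraticTwist (NumberField.discr K : ℚ) = Wd →
      (haveI : NeZero p := ⟨(Fact.out : p.Prime).ne_zero⟩
       haveI : NumberField (Wd.divisionField p) := NumberField.mk
       ¬ p ∣ NumberField.classNumber (Wd.divisionField p)) ∧
      (∀ v : HeightOneSpectrum (𝓞 ℚ), (((p : ℕ) : 𝓞 ℚ) ∈ v.asIdeal ∨ ¬ Wd.HasGoodReductionAt v) →
        ∀ x : Wd.geomPrimaryTorsion p, p • x = 0 →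
          (∀ d ∈ Literature.NumberTheory.EllipticCurves.GreenbergSelmer.decomp v, d • x = x) → x = 0)) :
    ∀ (W : WeierstrassCurve ℚ) [W.IsElliptic] [W.IsGloballyMinimal] (p : ℕ) [Fact p.Prime],
      W.analyticRank = 1 → N10.CellGordTwo W p → W.HasIrreducibleModPGaloisRep p →
      ¬ (∀ n : ℕ, W.HasSurjectiveModNGaloisRep (p ^ n : ℕ)) → Typed.MissingLowerBoundAt W p := by
  refine HeegnerKolyvagin.cellGordTwo_missingLowerBoundAt_rankOne_of_smallImage_of_adjustedIndexBound_of_classNumber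
    hGZ hKo hKatoI hDRS hGZK hmod hnf hmodP hFH hLsm ?_
  intro W _ _ p _ K _ _ Wd _ _ Cd hr hc2 hirr hns hK hHN hLt hWd
  obtain ⟨hCl, hloc⟩ := hClsm' W p K Wd Cd hr hc2 hirr hns hK hHN hLt hWd
  refine ⟨?_, hCl, hloc⟩
  haveI : NeZero p := ⟨(Fact.out : p.Prime).ne_zero⟩
  have hp2 : p ≠ 2 := hc2.1
  have hns1 : ¬ W.HasSurjectiveModNGaloisRep p :=
    not_hasSurjectiveModNGaloisRep_of_row W p hp2 hns fun h3 ↦ by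
      subst h3
      exact hns3 W hr hc2 hirr hns
  have hd : (NumberField.discr K : ℚ) ≠ 0 := Int.cast_ne_zero.mpr (NumberField.discr_ne_zero K)
  exact not_dvd_card_aut_divisionField_of_smul_eq_quadraticTwist p W Wd hp2 hd hWd hirr hns1

end Summit.BirchSwinnertonDyer.BirchSwinnertonDyer.Theorems.AdditiveBranchIMCGordTwoRankOne.SmallImageDickson

end
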